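import Summits.SmoothPoincare4.SmoothPoincare4.Theorems.SullivanDualWitnessChargeDefs
import Literature.Geometry.Symplectic.JHolomorphicLimitEmbedded
import Mathlib.Geometry.Manifold.ContMDiff.Atlas

/-!
# D1b of line `Sketch` (crux `WitnessCharge`) from McDuff's theorem on limits of embedded `J`-discs

Crux `WitnessCharge` (stmt-SmoothPoincare4-7824), line `Sketch`, skeleton v7, deep stub D1b
`substub_limitEmbedded`. The stub is the special case `V = Σ ∖ p` of a published theorem of the
local theory of `J`-holomorphic curves in almost complex 4-manifolds (McDuff 1991, §4), stated
in the tree as the named fact `Literature.Geometry.Symplectic.jHolomorphicLimitOfEmbedded_isEmbedded`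
(`Literature/Geometry/Symplectic/JHolomorphicLimitEmbedded.lean`, proposal p129623), and `substub_limitEmbedded_of_mcduff` is the instantiation.

## References
* D. McDuff, *The local behaviour of holomorphic curves in almost complex 4-manifolds*, J. Diff.
  Geom. 34 (1991) 143–164: Def. 4.1 and Lemma 4.2(i) (p. 158–159), Lemma 4.3 (p. 159), Cor. 4.4
  (p. 160), Thm 1.1 (p. 143), Thm 1.4 (p. 144) and the proof of Thm 1.3 ((5.5), p. 163).
* C. Hummel, *Gromov's compactness theorem for pseudo-holomorphic curves*, Birkhäuser 1997,
  Ch. III Prop. 3.1 (`C⁰_loc`-convergence of `J`-holomorphic maps is `C^∞_loc`; tree: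
  `Literature.Geometry.Symplectic.JHolomorphicWeierstrassR4`, proved).
-/

noncomputable section

set_option linter.dupNamespace false

open scoped Manifold ContDiff Topology
open Set Filter Literature.Geometry.Symplectic Literature.Topology.FourManifolds

namespace Summit.SmoothPoincare4.SmoothPoincare4.Theorems.WitnessCharge.PencilIncompleteness

/-- The inclusion `Σ∖p ↪ Σ` followed by a smooth injective immersion `ι : Σ → ℝᴺ` of the compact
`Σ` is a topological embedding, smooth, with injective differential. -/
theorem embedding_comp_val {S : HomotopySphere 4} (p : S.carrier) {N : ℕ}
    {ι : S.carrier → EuclideanSpace ℝ (Fin N)}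
    (hι : ContMDiff (𝓡 4) 𝓘(ℝ, EuclideanSpace ℝ (Fin N)) ∞ ι) (hιinj : Function.Injective ι)
    (hιd : ∀ x : S.carrier, Function.Injective (mfderiv (𝓡 4) 𝓘(ℝ, EuclideanSpace ℝ (Fin N)) ι x)) :
    Topology.IsEmbedding (fun x : punctured p => ι x.1) ∧
      ContMDiff (𝓡 4) 𝓘(ℝ, EuclideanSpace ℝ (Fin N)) ∞ (fun x : punctured p => ι x.1) ∧
      ∀ x : punctured p,
        Function.Injective (mfderiv (𝓡 4) 𝓘(ℝ, EuclideanSpace ℝ (Fin N)) (fun x : punctured p => ι x.1) x) := by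
  refine ⟨(hι.continuous.isClosedEmbedding hιinj).isEmbedding.comp Topology.IsEmbedding.subtypeVal,
    hι.comp contMDiff_subtype_val, fun x => ?_⟩
  have hcomp : (fun x : punctured p => ι x.1) = ι ∘ (Subtype.val : punctured p → S.carrier) := rfl
  rw [hcomp, mfderiv_comp x (hι.mdifferentiableAt (by simp))
    (Literature.Geometry.Manifold.OpenSubmanifold.mdifferentiableAt_subtype_val x),
    Literature.Geometry.Manifold.OpenSubmanifold.mfderiv_subtype_val]
  intro v w hvw
  exact hιd x.1 hvw

/-- **D1b from McDuff's theorem (registered helper `substub_limitEmbedded_of_mcduff`).** GIVEN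
the named fact `jHolomorphicLimitOfEmbedded_isEmbedded` (McDuff 1991 §4), the deep stub D1b of
skeleton v7 holds: instantiate `V := Σ ∖ p` (an open submanifold of the homotopy sphere, second
countable Hausdorff) with the embedding `x ↦ ι x.1`. -/
theorem substub_limitEmbedded_of_mcduff :
    Literature.Geometry.Symplectic.jHolomorphicLimitOfEmbedded_isEmbedded →
    ∀ (S : HomotopySphere 4) (p : S.carrier)
      (J : ∀ x : punctured p, TangentSpace (𝓡 4) x →L[ℝ] TangentSpace (𝓡 4) x),
      (∀ (x : punctured p) (v : TangentSpace (𝓡 4) x), J x (J x v) = -v) →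
      (∀ x₀ : punctured p, ContMDiffAt (𝓡 4) 𝓘(ℝ, EuclideanSpace ℝ (Fin 4) →L[ℝ] EuclideanSpace ℝ (Fin 4)) ∞
        (inTangentCoordinates (𝓡 4) (𝓡 4) (id : punctured p → punctured p) id (fun x => J x) x₀) x₀) →
      ∀ (N : ℕ) (ι : S.carrier → EuclideanSpace ℝ (Fin N)),
        ContMDiff (𝓡 4) 𝓘(ℝ, EuclideanSpace ℝ (Fin N)) ∞ ι → Function.Injective ι →
        (∀ x : S.carrier, Function.Injective (mfderiv (𝓡 4) 𝓘(ℝ, EuclideanSpace ℝ (Fin N)) ι x)) →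
      ∀ (u : ℕ → ℂ → punctured p) (G : ℂ → punctured p) (r₀ r₁ : ℝ), 0 < r₀ → r₀ < r₁ →
        (∀ n, IsEntireJCurve (𝓡 4) J (u n)) → (∀ n, Function.Injective (u n)) →
        (∀ n (ξ : ℂ), Function.Injective (mfderiv 𝓘(ℝ, ℂ) (𝓡 4) (u n) ξ)) →
        ContMDiff 𝓘(ℝ, ℂ) (𝓡 4) ∞ G → IsJHolomorphic (𝓡 4) J G →
        (∀ D : Set ℂ, IsCompact D →
          TendstoUniformlyOn (fun n ζ => ι (u n ζ).1) (fun ζ => ι (G ζ).1) atTop D) →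
        Set.InjOn G {ξ : ℂ | r₀ < ‖ξ‖ ∧ ‖ξ‖ < r₁} →
        (∀ ξ : ℂ, r₀ < ‖ξ‖ → ‖ξ‖ < r₁ → Function.Injective (mfderiv 𝓘(ℝ, ℂ) (𝓡 4) G ξ)) →
        (∀ ξ ξ' : ℂ, ‖ξ‖ ≤ r₀ → r₀ < ‖ξ'‖ → ‖ξ'‖ < r₁ → G ξ ≠ G ξ') →
        Set.InjOn G (Metric.ball (0 : ℂ) r₁) ∧
          ∀ ξ ∈ Metric.ball (0 : ℂ) r₁, Function.Injective (mfderiv 𝓘(ℝ, ℂ) (𝓡 4) G ξ) := by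
  intro hMcD S p J hJ2 hJs N ι hι hιinj hιd u G r₀ r₁ hr₀ hr₁ hu hinj himm hGs hGJ hunif hinjA himmA hsep
  obtain ⟨hemb, hιs, hιd'⟩ := embedding_comp_val p hι hιinj hιd
  exact hMcD (punctured p) J hJ2 hJs N (fun x : punctured p => ι x.1) hemb hιs hιd' u G r₀ r₁ hr₀ hr₁
    (fun n => (hu n).1) (fun n => (hu n).2.2) hinj himm hGs hGJ hunif hinjA himmA hsep

end Summit.SmoothPoincare4.SmoothPoincare4.Theorems.WitnessCharge.PencilIncompleteness
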